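import Summits.QuantumFields.YangMills.Theorems.LuscherReductionTwistedTraceScalingBTOffDiagonalRatio
import Literature.MathematicalPhysics.QuantumLattice.SU2HaarSmallBallUpper
import HarnessLib

/-!
# The MIXED SECOND DIFFERENCE of the tube exponent is exact algebra and second order: `offX(u,u') + offX(u',u) = −2β Σ_e {Re[c_eΔ_k g_y Δ̄_k c̄'_e ḡ_x] − ‖Δ_k‖²}`,
# `Δ_k = q(u_k) − q(u'_k)`, hence `|offX(u,u') + offX(u',u)| ≤ β Σ_e ‖Δ_k‖²·(‖q(c_e)−1‖ + ‖q(g_x)−1‖ + ‖q(c'_e)−1‖ + ‖q(g_y)−1‖)²`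
# (route `FlatTubeReduction`, crux K1 `NearFlatRatioLaw` stmt-QuantumFields-24720; seat `ym-line-ftr-p1` g15; rate twin «ratepack-v3 / frozen fibres»; R2b1 RECORD rung — no summit
# statement is proved here)

WHY (memo `Cruxes/NearFlatRatioLaw/Lines/ratepack-v3-frozen-g12.md` §5.1, §8.4; PICKED.md g15).  The symmetric kernel ratio lemma (`…SymmetricKernelRatio.symmetric_kernel_ratio`) turns the
K-near step of `stub_coreRateOfEM` into two POINTWISE inputs on the off-diagonal Laplace exponent `offX` of lane A (`…BTOffDiagonalRatio`): the first-order bound `|offX| ≤ η`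
(`…BTOffDiagonalBound.abs_offX_le`) and a bound `ξ` on the MIXED SECOND DIFFERENCE `offX β u u' v v' g + offX β u' u v v' g` (= `E₁₂ + E₂₁ − E₁₁ − E₂₂` for the exponents
`E_{ij} = log K_β(oT u_i v, g·oT u_j v') − log K₁^{(L³β)}(u_i,u_j)`).  This file computes that difference EXACTLY — no expansion, no calculus:
* the magnetic terms cancel identically (each is a function of one slow variable);
* the time coupling `Σ_e Re tr(U_e V_e⁻¹)` is bilinear in the link matrices, so the mixed difference of the kinetic terms is minus the coupling of the DIFFERENCE fields
  `(oT u v)_e − (oT u' v)_e = c_e·Δ_k`: `re_trace_orthoTube_gauge` (per-link quaternion form), `quat_mixed_re` (the bilinear identity), ★★ `offX_add_offX_swap` (the exact formula);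
* `quat_mixed_abs_le` (with `abs_re_le_norm` of `SU2HaarSmallBallUpper`) — for unit `c, h, c', g` and any `Δ`: `|Re(cΔhΔ̄c̄'ḡ) − ‖Δ‖²| ≤ ½‖Δ‖²(‖c−1‖+‖g−1‖+‖c'−1‖+‖h−1‖)²` (at `c = c'`, `g = h = 1` the term is EXACTLY `‖Δ‖²`: the constant lift is
  a critical point, so the fast variables enter quadratically), ★★★ `abs_offX_add_offX_swap_le` — the pointwise bound.
Sizes: `‖Δ_k‖ ≤ α ≍ √(log B/B)` (near pairs), fast radii `≍ β^{-1/2}polylog` ⇒ `ξ = O(β|E|α²·β^{-1}polylog) = O(β⁻¹polylog) ≪ λ_b² ≍ β^{-2/3}`.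
HONEST FRAMING: exact fixed-lattice algebra for a stub of the CONDITIONAL reduction route R2b1; (B-T) at rate remains to be assembled; femto rung R2b1 (RECORD label); not infinite volume,
not a gap, not Clay.  No defs, no named facts, no `sorry`.
-/

set_option autoImplicit false

noncomputable section

open MeasureTheory Filter Topology Real
open scoped BigOperators Matrix Quaternion
open Literature.MathematicalPhysics.QuantumFieldTheory
open Literature.MathematicalPhysics.QuantumLattice

namespace Summit.QuantumFields.YangMills.Theorems.FemtoTransferGap.TwoLattice.ConstTube

open Summit.QuantumFields.YangMills.Theorems.FemtoTransferGap
open Summit.QuantumFields.YangMills.Theorems.FemtoTransferGap.TwoLattice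
open Literature.MathematicalPhysics.QuantumFieldTheory.Balaban1983to89.T4WilsonLinkAffine (su2Quat_inv)

variable {L : ℕ} [NeZero L]

/-! ## §1 Quaternion algebra -/

omit [NeZero L] in
/-- `Re(x·x̄) = ‖x‖²`. [folklore] -/
theorem quat_re_mul_star_self (x : ℍ) : (x * star x).re = ‖x‖ ^ 2 := by
  rw [Quaternion.self_mul_star, Quaternion.re_coe, Quaternion.normSq_eq_norm_mul_self, sq]

omit [NeZero L] in
/-- For a unit quaternion `Q`: `Re Q − 1 = −‖Q − 1‖²/2`. [folklore] -/
theorem quat_re_sub_one_of_norm_one {Q : ℍ} (hQ : ‖Q‖ = 1) : Q.re - 1 = -‖Q - 1‖ ^ 2 / 2 := by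
  have h1 : ‖Q - 1‖ ^ 2 = Quaternion.normSq Q - 2 * Q.re + 1 := by
    rw [sq, ← Quaternion.normSq_eq_norm_mul_self]
    simp only [Quaternion.normSq_def', Quaternion.re_sub, Quaternion.imI_sub, Quaternion.imJ_sub, Quaternion.imK_sub, Quaternion.re_one, Quaternion.imI_one,
      Quaternion.imJ_one, Quaternion.imK_one]
    ring
  have h2 : Quaternion.normSq Q = 1 := by rw [Quaternion.normSq_eq_norm_mul_self, hQ, mul_one]
  rw [h1, h2]; ring

omit [NeZero L] in
/-- The bilinear identity behind the mixed difference: with `T(a,b) = Re(c·a·h·b̄·c̄'·ḡ)`,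
`T(a,b) + T(b,a) − T(a,a) − T(b,b) = −Re(c(a−b)h(a−b)‾c̄'ḡ)`, and `Re(ab̄) + Re(bā) − Re(aā) − Re(bb̄) = −‖a − b‖²`. [folklore] -/
theorem quat_mixed_re (c h c' g a b : ℍ) :
    (c * a * h * star b * star c' * star g).re + (c * b * h * star a * star c' * star g).re - (c * a * h * star a * star c' * star g).re -
        (c * b * h * star b * star c' * star g).re = -(c * (a - b) * h * star (a - b) * star c' * star g).re ∧
      (a * star b).re + (b * star a).re - (a * star a).re - (b * star b).re = -‖a - b‖ ^ 2 := by
  constructor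
  · have e : c * (a - b) * h * star (a - b) * star c' * star g = c * a * h * star a * star c' * star g - c * a * h * star b * star c' * star g -
        c * b * h * star a * star c' * star g + c * b * h * star b * star c' * star g := by
      rw [star_sub]; noncomm_ring
    rw [e, Quaternion.re_add, Quaternion.re_sub, Quaternion.re_sub]; ring
  · have e : (a - b) * star (a - b) = a * star a - a * star b - b * star a + b * star b := by rw [star_sub]; noncomm_ring
    rw [← quat_re_mul_star_self, e, Quaternion.re_add, Quaternion.re_sub, Quaternion.re_sub]; ring

omit [NeZero L] in
/-- ★ **The per-link mixed term is second order in the fast variables**: for unit `c, h, c', g` and any `Δ`,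
`|Re(cΔhΔ̄c̄'ḡ) − ‖Δ‖²| ≤ ½‖Δ‖²(‖c−1‖ + ‖g−1‖ + ‖c'−1‖ + ‖h−1‖)²` (EXACTLY `‖Δ‖²` at `c = c'`, `g = h = 1`). [folklore] -/
theorem quat_mixed_abs_le {c h c' g : ℍ} (hc : ‖c‖ = 1) (hh : ‖h‖ = 1) (hc' : ‖c'‖ = 1) (hg : ‖g‖ = 1) (Δ : ℍ) :
    |(c * Δ * h * star Δ * star c' * star g).re - ‖Δ‖ ^ 2| ≤ ‖Δ‖ ^ 2 * (‖c - 1‖ + ‖g - 1‖ + ‖c' - 1‖ + ‖h - 1‖) ^ 2 / 2 := by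
  have re_comm : ∀ x y : ℍ, (x * y).re = (y * x).re := fun x y => by rw [Quaternion.re_mul, Quaternion.re_mul]; ring
  have re_mul_coe : ∀ (x : ℍ) (r : ℝ), (x * (r : ℍ)).re = x.re * r := fun x r => by
    rw [Quaternion.re_mul]; simp [Quaternion.re_coe, Quaternion.imI_coe, Quaternion.imJ_coe, Quaternion.imK_coe]
  obtain ⟨Q, hQ⟩ : ∃ Q : ℍ, Q = star c' * star g * c := ⟨_, rfl⟩
  have hQ1 : ‖Q‖ = 1 := by rw [hQ, norm_mul, norm_mul, norm_star, norm_star, hc', hg, hc]; norm_num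
  have hcyc : (c * Δ * h * star Δ * star c' * star g).re = (h * star Δ * Q * Δ).re := by
    have e1 : c * Δ * h * star Δ * star c' * star g = (c * Δ) * (h * star Δ * star c' * star g) := by noncomm_ring
    have e2 : h * star Δ * Q * Δ = (h * star Δ * star c' * star g) * (c * Δ) := by rw [hQ]; noncomm_ring
    rw [e1, e2]; exact re_comm _ _
  have hexp : h * star Δ * Q * Δ = star Δ * Δ + star Δ * ((Q - 1) * Δ) + (h - 1) * (star Δ * Δ) + (h - 1) * star Δ * (Q - 1) * Δ := by noncomm_ring
  have hn : star Δ * Δ = ((‖Δ‖ ^ 2 : ℝ) : ℍ) := by rw [Quaternion.star_mul_self, Quaternion.normSq_eq_norm_mul_self, sq]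
  have t1 : (star Δ * Δ).re = ‖Δ‖ ^ 2 := by rw [hn, Quaternion.re_coe]
  have t2 : (star Δ * ((Q - 1) * Δ)).re = ‖Δ‖ ^ 2 * (Q.re - 1) := by
    rw [re_comm, mul_assoc, Quaternion.self_mul_star, re_mul_coe, Quaternion.normSq_eq_norm_mul_self, Quaternion.re_sub, Quaternion.re_one]; ring
  have t3 : ((h - 1) * (star Δ * Δ)).re = ‖Δ‖ ^ 2 * (h.re - 1) := by
    rw [hn, re_mul_coe, Quaternion.re_sub, Quaternion.re_one]; ring
  have t4 : |((h - 1) * star Δ * (Q - 1) * Δ).re| ≤ ‖h - 1‖ * ‖Q - 1‖ * ‖Δ‖ ^ 2 := by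
    refine (abs_re_le_norm _).trans ?_
    rw [norm_mul, norm_mul, norm_mul, norm_star]; nlinarith [norm_nonneg Δ, norm_nonneg (h - 1), norm_nonneg (Q - 1)]
  have hQb : ‖Q - 1‖ ≤ ‖c - 1‖ + ‖g - 1‖ + ‖c' - 1‖ := by
    have e : Q - 1 = star c' * star g * (c - 1) + star c' * (star g - 1) + (star c' - 1) := by rw [hQ]; noncomm_ring
    rw [e]
    have hg1 : ‖star g - 1‖ = ‖g - 1‖ := by rw [← norm_star (g - 1), star_sub, star_one]
    have hc1 : ‖star c' - 1‖ = ‖c' - 1‖ := by rw [← norm_star (c' - 1), star_sub, star_one]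
    calc ‖star c' * star g * (c - 1) + star c' * (star g - 1) + (star c' - 1)‖
        ≤ ‖star c' * star g * (c - 1)‖ + ‖star c' * (star g - 1)‖ + ‖star c' - 1‖ := norm_add₃_le
      _ = ‖c - 1‖ + ‖g - 1‖ + ‖c' - 1‖ := by rw [norm_mul, norm_mul, norm_mul, norm_star, norm_star, hc', hg, hg1, hc1]; ring
  rw [hcyc, hexp, Quaternion.re_add, Quaternion.re_add, Quaternion.re_add, t1, t2, t3, quat_re_sub_one_of_norm_one hQ1, quat_re_sub_one_of_norm_one hh]
  have hr := abs_le.mp t4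
  have hA0 : 0 ≤ ‖c - 1‖ + ‖g - 1‖ + ‖c' - 1‖ := by positivity
  have hQ0 : 0 ≤ ‖Q - 1‖ := norm_nonneg _
  have hh0 : 0 ≤ ‖h - 1‖ := norm_nonneg _
  have hD0 : 0 ≤ ‖Δ‖ ^ 2 := sq_nonneg _
  rw [abs_le]
  constructor
  · nlinarith [mul_le_mul_of_nonneg_left hQb hD0, mul_le_mul_of_nonneg_left (mul_le_mul hQb le_rfl hh0 hA0) hD0,
      mul_le_mul_of_nonneg_left (mul_le_mul hQb hQb hQ0 hA0) hD0, hr.1, hr.2]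
  · nlinarith [mul_le_mul_of_nonneg_left hQb hD0, mul_le_mul_of_nonneg_left (mul_le_mul hQb le_rfl hh0 hA0) hD0,
      mul_le_mul_of_nonneg_left (mul_le_mul hQb hQb hQ0 hA0) hD0, hr.1, hr.2]

/-! ## §2 The per-link kinetic terms as quaternion products -/

omit [NeZero L] in
/-- The tube link term of `TC(oT a v, g·oT b v')`: `Re tr(c_e a_k g_y b_k⁻¹ c'_e⁻¹ g_x⁻¹) = 2Re(q(c_e)q(a_k)q(g_y)q̄(b_k)q̄(c'_e)q̄(g_x))`. [folklore] -/
theorem re_trace_orthoTube_gauge (a b : GaugeConfig 3 1 SU2) (g : Site 3 L → SU2) (v v' : Edge 3 L → Fin 3 → ℝ) (e : Edge 3 L) :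
    ((su2Rep (orthoTube L a v e * (gaugeTransform g (orthoTube L b v') e)⁻¹)).trace).re =
      2 * (su2Quat (chartSU2 (v e)) * su2Quat (a (0, e.2)) * su2Quat (g (e.1.shift e.2)) * star (su2Quat (b (0, e.2))) * star (su2Quat (chartSU2 (v' e))) *
        star (su2Quat (g e.1))).re := by
  simp only [orthoTube_apply, gaugeTransform, mul_inv_rev, inv_inv, fundamentalRep_apply, re_trace_eq_two_mul_scalarPart, scalarPart, su2Quat_mul, su2Quat_inv, mul_assoc]

omit [NeZero L] in
/-- The one-site link term: `Re tr(a_k b_k⁻¹) = 2Re(q(a_k)q̄(b_k))` on the constant lifts. [folklore] -/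
theorem re_trace_constLift (a b : GaugeConfig 3 1 SU2) (e : Edge 3 L) :
    ((su2Rep (constLift L a e * (constLift L b e)⁻¹)).trace).re = 2 * (su2Quat (a (0, e.2)) * star (su2Quat (b (0, e.2)))).re := by
  simp only [constLift_apply, fundamentalRep_apply, re_trace_eq_two_mul_scalarPart, scalarPart, su2Quat_mul, su2Quat_inv]

/-! ## §3 ★★ The exact mixed second difference -/

/-- ★★ **EXACT MIXED SECOND DIFFERENCE of the tube exponent**: the magnetic terms cancel and the kinetic ones are bilinear, so
`offX β u u' v v' g + offX β u' u v v' g = −2β Σ_e {Re(q(c_e)Δ_k q(g_y)Δ̄_k q̄(c'_e)q̄(g_x)) − ‖Δ_k‖²}`, `Δ_k = q(u_k) − q(u'_k)`, `c_e = chartSU2 v_e`, `c'_e = chartSU2 v'_e`, `e = (x,k)`, `y = x + k̂`.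
[cite: Luscher1983, §3] -/
theorem offX_add_offX_swap (β : ℝ) (u u' : GaugeConfig 3 1 SU2) (v v' : Edge 3 L → Fin 3 → ℝ) (g : Site 3 L → SU2) :
    offX L β u u' v v' g + offX L β u' u v v' g =
      -(2 * β) * ∑ e : Edge 3 L, ((su2Quat (chartSU2 (v e)) * (su2Quat (u (0, e.2)) - su2Quat (u' (0, e.2))) * su2Quat (g (e.1.shift e.2)) *
          star (su2Quat (u (0, e.2)) - su2Quat (u' (0, e.2))) * star (su2Quat (chartSU2 (v' e))) * star (su2Quat (g e.1))).re -
        ‖su2Quat (u (0, e.2)) - su2Quat (u' (0, e.2))‖ ^ 2) := by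
  have hT : ∀ a b : GaugeConfig 3 1 SU2, timeCoupling su2Rep (orthoTube L a v) (gaugeTransform g (orthoTube L b v')) =
      ∑ e : Edge 3 L, 2 * (su2Quat (chartSU2 (v e)) * su2Quat (a (0, e.2)) * su2Quat (g (e.1.shift e.2)) * star (su2Quat (b (0, e.2))) * star (su2Quat (chartSU2 (v' e))) *
        star (su2Quat (g e.1))).re := fun a b => by
    unfold timeCoupling; exact Finset.sum_congr rfl fun e _ => re_trace_orthoTube_gauge a b g v v' e
  have hC : ∀ a b : GaugeConfig 3 1 SU2, (L : ℝ) ^ 3 * timeCoupling su2Rep a b = ∑ e : Edge 3 L, 2 * (su2Quat (a (0, e.2)) * star (su2Quat (b (0, e.2)))).re := fun a b => by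
    rw [← timeCoupling_constLift su2Rep L a b]; unfold timeCoupling; exact Finset.sum_congr rfl fun e _ => re_trace_constLift a b e
  have key : ∀ e : Edge 3 L,
      2 * (su2Quat (chartSU2 (v e)) * su2Quat (u (0, e.2)) * su2Quat (g (e.1.shift e.2)) * star (su2Quat (u' (0, e.2))) * star (su2Quat (chartSU2 (v' e))) * star (su2Quat (g e.1))).re +
        2 * (su2Quat (chartSU2 (v e)) * su2Quat (u' (0, e.2)) * su2Quat (g (e.1.shift e.2)) * star (su2Quat (u (0, e.2))) * star (su2Quat (chartSU2 (v' e))) * star (su2Quat (g e.1))).re -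
        2 * (su2Quat (chartSU2 (v e)) * su2Quat (u (0, e.2)) * su2Quat (g (e.1.shift e.2)) * star (su2Quat (u (0, e.2))) * star (su2Quat (chartSU2 (v' e))) * star (su2Quat (g e.1))).re -
        2 * (su2Quat (chartSU2 (v e)) * su2Quat (u' (0, e.2)) * su2Quat (g (e.1.shift e.2)) * star (su2Quat (u' (0, e.2))) * star (su2Quat (chartSU2 (v' e))) * star (su2Quat (g e.1))).re -
        (2 * (su2Quat (u (0, e.2)) * star (su2Quat (u' (0, e.2)))).re + 2 * (su2Quat (u' (0, e.2)) * star (su2Quat (u (0, e.2)))).re -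
          2 * (su2Quat (u (0, e.2)) * star (su2Quat (u (0, e.2)))).re - 2 * (su2Quat (u' (0, e.2)) * star (su2Quat (u' (0, e.2)))).re) =
      -2 * ((su2Quat (chartSU2 (v e)) * (su2Quat (u (0, e.2)) - su2Quat (u' (0, e.2))) * su2Quat (g (e.1.shift e.2)) *
          star (su2Quat (u (0, e.2)) - su2Quat (u' (0, e.2))) * star (su2Quat (chartSU2 (v' e))) * star (su2Quat (g e.1))).re -
        ‖su2Quat (u (0, e.2)) - su2Quat (u' (0, e.2))‖ ^ 2) := fun e => by
    have h := quat_mixed_re (su2Quat (chartSU2 (v e))) (su2Quat (g (e.1.shift e.2))) (su2Quat (chartSU2 (v' e))) (su2Quat (g e.1)) (su2Quat (u (0, e.2))) (su2Quat (u' (0, e.2)))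
    linear_combination 2 * h.1 - 2 * h.2
  unfold offX
  rw [hT u u', hT u u, hT u' u, hT u' u', hC u u', hC u u, hC u' u, hC u' u']
  calc _ = β * ∑ e : Edge 3 L,
        (2 * (su2Quat (chartSU2 (v e)) * su2Quat (u (0, e.2)) * su2Quat (g (e.1.shift e.2)) * star (su2Quat (u' (0, e.2))) * star (su2Quat (chartSU2 (v' e))) * star (su2Quat (g e.1))).re +
        2 * (su2Quat (chartSU2 (v e)) * su2Quat (u' (0, e.2)) * su2Quat (g (e.1.shift e.2)) * star (su2Quat (u (0, e.2))) * star (su2Quat (chartSU2 (v' e))) * star (su2Quat (g e.1))).re -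
        2 * (su2Quat (chartSU2 (v e)) * su2Quat (u (0, e.2)) * su2Quat (g (e.1.shift e.2)) * star (su2Quat (u (0, e.2))) * star (su2Quat (chartSU2 (v' e))) * star (su2Quat (g e.1))).re -
        2 * (su2Quat (chartSU2 (v e)) * su2Quat (u' (0, e.2)) * su2Quat (g (e.1.shift e.2)) * star (su2Quat (u' (0, e.2))) * star (su2Quat (chartSU2 (v' e))) * star (su2Quat (g e.1))).re -
        (2 * (su2Quat (u (0, e.2)) * star (su2Quat (u' (0, e.2)))).re + 2 * (su2Quat (u' (0, e.2)) * star (su2Quat (u (0, e.2)))).re -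
          2 * (su2Quat (u (0, e.2)) * star (su2Quat (u (0, e.2)))).re - 2 * (su2Quat (u' (0, e.2)) * star (su2Quat (u' (0, e.2)))).re)) := by
        simp only [Finset.sum_add_distrib, Finset.sum_sub_distrib]; ring
    _ = _ := by rw [Finset.sum_congr rfl fun e _ => key e, ← Finset.mul_sum]; ring

/-! ## §4 ★★★ The pointwise bound -/

/-- ★★★ **POINTWISE BOUND ON THE MIXED SECOND DIFFERENCE**: for `β ≥ 0`,
`|offX β u u' v v' g + offX β u' u v v' g| ≤ β Σ_e ‖q(u_k) − q(u'_k)‖²·(‖q(c_e)−1‖ + ‖q(g_x)−1‖ + ‖q(c'_e)−1‖ + ‖q(g_y)−1‖)²` — second order in the slow step times second order in the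
fast variables. [cite: Luscher1983, §3] -/
theorem abs_offX_add_offX_swap_le {β : ℝ} (hβ : 0 ≤ β) (u u' : GaugeConfig 3 1 SU2) (v v' : Edge 3 L → Fin 3 → ℝ) (g : Site 3 L → SU2) :
    |offX L β u u' v v' g + offX L β u' u v v' g| ≤
      β * ∑ e : Edge 3 L, ‖su2Quat (u (0, e.2)) - su2Quat (u' (0, e.2))‖ ^ 2 *
        (‖su2Quat (chartSU2 (v e)) - 1‖ + ‖su2Quat (g e.1) - 1‖ + ‖su2Quat (chartSU2 (v' e)) - 1‖ + ‖su2Quat (g (e.1.shift e.2)) - 1‖) ^ 2 := by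
  rw [offX_add_offX_swap, abs_mul, abs_neg, abs_of_nonneg (by linarith : (0 : ℝ) ≤ 2 * β)]
  have hsum := Finset.abs_sum_le_sum_abs (s := Finset.univ) (fun e : Edge 3 L =>
    (su2Quat (chartSU2 (v e)) * (su2Quat (u (0, e.2)) - su2Quat (u' (0, e.2))) * su2Quat (g (e.1.shift e.2)) *
          star (su2Quat (u (0, e.2)) - su2Quat (u' (0, e.2))) * star (su2Quat (chartSU2 (v' e))) * star (su2Quat (g e.1))).re -
        ‖su2Quat (u (0, e.2)) - su2Quat (u' (0, e.2))‖ ^ 2)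
  have hper : ∀ e : Edge 3 L,
      |(su2Quat (chartSU2 (v e)) * (su2Quat (u (0, e.2)) - su2Quat (u' (0, e.2))) * su2Quat (g (e.1.shift e.2)) *
          star (su2Quat (u (0, e.2)) - su2Quat (u' (0, e.2))) * star (su2Quat (chartSU2 (v' e))) * star (su2Quat (g e.1))).re -
        ‖su2Quat (u (0, e.2)) - su2Quat (u' (0, e.2))‖ ^ 2| ≤
      ‖su2Quat (u (0, e.2)) - su2Quat (u' (0, e.2))‖ ^ 2 *
        (‖su2Quat (chartSU2 (v e)) - 1‖ + ‖su2Quat (g e.1) - 1‖ + ‖su2Quat (chartSU2 (v' e)) - 1‖ + ‖su2Quat (g (e.1.shift e.2)) - 1‖) ^ 2 / 2 := fun e =>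
    quat_mixed_abs_le (norm_su2Quat _) (norm_su2Quat _) (norm_su2Quat _) (norm_su2Quat _) _
  calc 2 * β * |∑ e : Edge 3 L, ((su2Quat (chartSU2 (v e)) * (su2Quat (u (0, e.2)) - su2Quat (u' (0, e.2))) * su2Quat (g (e.1.shift e.2)) *
          star (su2Quat (u (0, e.2)) - su2Quat (u' (0, e.2))) * star (su2Quat (chartSU2 (v' e))) * star (su2Quat (g e.1))).re -
        ‖su2Quat (u (0, e.2)) - su2Quat (u' (0, e.2))‖ ^ 2)|
      ≤ 2 * β * ∑ e : Edge 3 L, ‖su2Quat (u (0, e.2)) - su2Quat (u' (0, e.2))‖ ^ 2 *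
          (‖su2Quat (chartSU2 (v e)) - 1‖ + ‖su2Quat (g e.1) - 1‖ + ‖su2Quat (chartSU2 (v' e)) - 1‖ + ‖su2Quat (g (e.1.shift e.2)) - 1‖) ^ 2 / 2 :=
        mul_le_mul_of_nonneg_left (hsum.trans (Finset.sum_le_sum fun e _ => hper e)) (by linarith)
    _ = _ := by rw [Finset.mul_sum, Finset.mul_sum]; exact Finset.sum_congr rfl fun e _ => by ring

end Summit.QuantumFields.YangMills.Theorems.FemtoTransferGap.TwoLattice.ConstTube

end
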